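import Literature.MathematicalPhysics.QuantumFieldTheory.Balaban1983to89.B8LeafKnitZd3B9All

/-!
# `Balaban1983to89.B8LeafKnitZd3OfThm4` — [Balaban1985RegularSpaces] the N05 prototype chain «Theorem 4 ⇒ Theorem 2 ⇒ Theorem 2 as
# printed ⇒ the re-typed leaf `B8LeafRS`» with THEOREM 4 ENTERED AS A HYPOTHESIS (socket-free glue)

statement-level skeleton of published theorems with citation tags; proofs where landed; nothing here is a claim about the
Yang–Mills mass gap

PDF held: `paper:balaban1985-cmp99-regular-spaces-gauge-fixing` (journal page = PDF page + 74); pp. 83, 87–88, 94–95.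

WHY THIS FILE (cell `pub-ymgap`, seat `pub-ymgap-dag-n05-a` g7, socket owner of the N05 knit).  The g5/g6 chain
`B8LeafModelZd3.thm4Printed_zd3_of_HFP₄ → B8LeafModelZd3Thm2.thm2Printed_zd3_univ → B8LeafModelZd3Thm2Of135.thm2_of135_zd3_univ →
B8LeafKnitZd3B9All.b8LeafRS_zd3_univ_b9all` threads the Theorem-4 SOCKET LIST (`SockHFP₀ SockHFP SockH59 SockP5u`) through every stage,
although every stage after the first consumes Theorem 4 only through the sentence `B8.Thm4Printed (5dLB₀) fam₃`.  When a socket is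
re-typed (today: the Proposition-5 uniqueness socket `SockP5u ↦ B8LeafModelZdSockP5uE.SockP5uE`, n04-b g5 LOCATED-1) the whole chain would
have to be copied.  This file factors the chain ONCE through the printed sentences: `thm2Printed_zd3_univ_of_thm4` (Theorem 2, (1.66)₁
form, from `H4 : B8.Thm4Printed …` + the Prop-3-frame b9 socket), `thm2_of135_zd3_univ_of_thm2` (Theorem 2 as printed from `H2 :
B8.Thm2Printed …`), `b8LeafRS_zd3_univ_of_thm4` / `_b9all` (the re-typed leaf from `H4` + b9 + the five remaining printed members).  The
proofs are the landed ones verbatim with the first `obtain` reading the hypothesis; the E-chain (`B8LeafKnitZd3E`) and any later provider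
chain instantiate these by name.

WHAT THIS FILE PROVES (kernel, 0 sorry, theorems only): `thm2Printed_zd3_univ_of_thm4`, `thm2_of135_zd3_univ_of_thm2`,
`b8LeafRS_zd3_univ_of_thm4`, `b8LeafRS_zd3_univ_of_thm4_b9all`, `thm2_of135_zd3_univ_of_thm4_b9all`.

HONEST SCOPE.  Bookkeeping BY NAME; nothing of Theorems 2/4, Propositions 3/5, (1.42), (1.59), (1.65) is re-proved beyond the landed
assemblies; the prototype's declared readings (`B8LeafModelZd3` docstring) apply.  Count-neutral; N05 NOT discharged; nothing continuum /
ℝ⁴ / OS / mass-gap / Clay.  Unit `pub-ymgap-dag-n05-a` (g7), 2026-08-26.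
-/

noncomputable section

open NormedSpace

namespace Literature.MathematicalPhysics.QuantumFieldTheory.Balaban1983to89.B8LeafKnitZd3OfThm4

open Complex (I)
open MatrixLog B7Prop1Explicit B7Prop2Explicit B7Prop1Local B7Eq92Concrete
open B7Prop2Explicit (C0 c2')
open B7Prop3Flat (c3)
open B8Ineq132 (covDerivFwd InAk BondTouches Under)
open B8Eq119TwistedAxial (Restr129 InAx)
open B8Eq184Proof (gaugeExp cfgExp)
open B8Lemma1NonAbelian (mulCfg blockPairNA lemma1Printed_blockPairNA)
open B8Eq140Level (SideTouches)
open B8Eq146AExpansion (iEta)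
open B8Thm2LogB (blockTop)
open B8Ineq130 (tlo thi)
open B8Eq138LandauZd (IsLandau138W logCfg)
open B8Prop3GaugeFixedKLevel (mem_unitaryUnits_of_mgauge_eq mulCfg_eq_gaugeAct_of_mgauge_eq)
open B8Thm4AtLandau138 (mgauge_mgauge_inv)
open B8Thm4Windows (thm4_windows thm4_windows_extra)
open B8LeafKnit (thm4Printed_precomp prop3Printed_precomp)
open B8LeafKnitRS (B8LeafRS)
open B8LeafModelZd (ZdIdx)
open B8LeafModelZd3 (mlogCfg mlogCfg_spec zdGF3 SockB9P3 prop3Printed_zd3 prop3_windows)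
open B8Ineq166Univ (norm_pert_sub_one_le_univ)
open B8LeafModelZd3Ineq165 (avgClose_zdGF3_of135)
open B8Eq142KLevelTouching (H42_of_inAx_touching)
open B8LeafSocketsB9 (sockB9P3_of_allLevels)

-- `Site` alone could resolve to the torus sites of `Setup.lean`; re-export the `ℤ^d` sites of `B7Prop1Explicit`.
export B7Prop1Explicit (Site)

variable {d : ℕ}

/-! ## §1 Theorem 2 ((1.66)₁-typed) from `B8.Thm4Printed` as a hypothesis -/

section Thm2

variable {𝔸 : Type} [CStarAlgebra 𝔸] [Nontrivial 𝔸]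

/-- **THEOREM 2 (p. 83) in the (1.66)₁-typed form on the `Ω₀ = ℤᵈ` sub-family of `zdGF3`, FROM THEOREM 4 AS A HYPOTHESIS** — the
assembly of `B8LeafModelZd3Thm2.thm2Printed_zd3_univ` (p. 88 «Of course this theorem implies Theorem 2»: Theorem 4 at the (1.65)-shifted
pair, Proposition 3 at `α₂ = c⋆″`, (1.42) at `α₁`, (1.66)₀ on all bonds by `B8Ineq166Univ`) with `B8.Thm4Printed (5dLB₀)` on the prototype
family entered AS A HYPOTHESIS `H4` instead of being produced from the Proposition-5 / (1.59) sockets — so that ANY provider chain for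
Theorem 4 (the g4 sockets, the repaired uniqueness socket `SockP5uE`, a future letters family) feeds the same Theorem-2 assembly by name.
Remaining socket: `SB9` (in-edge b9 in Proposition 3's frame).  Constants `B₁ = 5dLB₀(1 + 11d²)`, `B₂ = 5dL·B₀β·(1 + 11d²)`.
[cite: Balaban1985RegularSpaces, Thm 2 p.83, Thm 4 p.88, Prop. 3 p.87, (1.65)–(1.66) p.87, (1.42) p.83] -/
theorem thm2Printed_zd3_univ_of_thm4 (hd2 : 2 ≤ d) {L : ℕ} (hL : 2 ≤ L) {β : ℝ} {len : Site d → ℝ}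
    {B₀ B₀' B₀β cB9 : ℝ} (hB₀ : 0 < B₀) (hB₀' : 0 < B₀') (hB₀β : 0 < B₀β) (hB : 2 ≤ 5 * (d : ℝ) * L * B₀) (hcB9 : 0 < cB9)
    (H4 : B8.Thm4Printed (5 * (d : ℝ) * L * B₀) (fun i : ZdIdx d L => (zdGF3 𝔸 L β len i).toGFData))
    (SB9 : ∀ i : ZdIdx d L, SockB9P3 (𝔸 := 𝔸) L B₀ B₀β cB9 β len i.η i.k i.Ω i.Λs i.Λb) :
    B8.Thm2Printed (fun i : {i : ZdIdx d L // i.Ω 0 = Set.univ} => (zdGF3 𝔸 L β len i.1).toGFData) := by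
  have hL1 : 1 ≤ L := le_trans (by norm_num) hL
  have hd1 : 1 ≤ d := le_trans (by norm_num) hd2
  have hL' : (1 : ℝ) ≤ L := by exact_mod_cast hL1
  have hd' : (1 : ℝ) ≤ d := by exact_mod_cast hd1
  -- the two instances, the windows
  obtain ⟨c4, hc4, H4⟩ := H4
  let inp : B8.B9Inputs := ⟨B₀, B₀', hB₀, hB₀'⟩
  obtain ⟨c3, hc3, H3⟩ := prop3Printed_zd3 (𝔸 := 𝔸) hd2 hL inp (B₀β := B₀β) (C₂ := 2097152 * ((d : ℝ) + 1) ^ 2) hB₀β.le le_rfl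
    hcB9 β len SB9
  obtain ⟨cw, hcw, hw⟩ := thm4_windows hd1 hL1 hB₀ hB₀' hB
  obtain ⟨cw', hcw', hw'⟩ := thm4_windows_extra (d := d) hL1
  -- constants
  set D : ℝ := 1 + 11 * (d : ℝ) ^ 2 with hD_def
  have hD1 : 1 ≤ D := le_add_of_nonneg_right (by positivity)
  have hD0 : 0 < D := lt_of_lt_of_le one_pos hD1
  have hDne : D ≠ 0 := hD0.ne'
  have hK₁ : 0 < 5 * (d : ℝ) * L * B₀ := by positivity
  have hK₂ : 0 < 5 * (d : ℝ) * L * B₀β := by positivity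
  set B₁ : ℝ := 5 * (d : ℝ) * L * B₀ * D with hB₁_def
  set B₂ : ℝ := 5 * (d : ℝ) * L * B₀β * D with hB₂_def
  have hB₁0 : 0 < B₁ := mul_pos hK₁ hD0
  have hB₂0 : 0 < B₂ := mul_pos hK₂ hD0
  have hK₁D : 0 < 5 * (d : ℝ) * L * B₀ * D := mul_pos hK₁ hD0
  have hK₁Dne : 5 * (d : ℝ) * L * B₀ * D ≠ 0 := hK₁D.ne'
  -- the threshold: the shifted pair must fit every window; Prop 3's three smallness conditions; the (1.65) window
  set cT : ℝ := min (min (c4 / D) (min (cw / D) (cw' / D)))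
    (min (min (c3 / D) (c3 / (5 * (d : ℝ) * L * B₀ * D))) (1 / (6 * D))) with hcT_def
  have hcT : 0 < cT :=
    lt_min (lt_min (div_pos hc4 hD0) (lt_min (div_pos hcw hD0) (div_pos hcw' hD0)))
      (lt_min (lt_min (div_pos hc3 hD0) (div_pos hc3 hK₁D)) (by positivity))
  refine ⟨B₁, B₂, cT, hB₁0, hB₂0, hcT, ?_⟩
  intro i α₀ α₁ hα₀ hα₁ hs U₀ P hInA hReg hInAAx havg
  have hS0 : 0 < α₀ + α₁ := add_pos hα₀ hα₁
  -- unpack the thresholds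
  have hle : ∀ {c : ℝ}, cT ≤ c / D → D * (α₀ + α₁) ≤ c := by
    intro c hc
    have h1 : α₀ + α₁ ≤ c / D := hs.trans hc
    calc D * (α₀ + α₁) ≤ D * (c / D) := mul_le_mul_of_nonneg_left h1 hD0.le
      _ = c := by field_simp
  have hs4 : D * (α₀ + α₁) ≤ c4 := hle ((min_le_left _ _).trans (min_le_left _ _))
  have hsw : D * (α₀ + α₁) ≤ cw := hle ((min_le_left _ _).trans ((min_le_right _ _).trans (min_le_left _ _)))
  have hsw' : D * (α₀ + α₁) ≤ cw' := hle ((min_le_left _ _).trans ((min_le_right _ _).trans (min_le_right _ _)))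
  have hs3 : D * (α₀ + α₁) ≤ c3 := hle ((min_le_right _ _).trans ((min_le_left _ _).trans (min_le_left _ _)))
  have hs3' : 5 * (d : ℝ) * L * B₀ * D * (α₀ + α₁) ≤ c3 := by
    have h1 : α₀ + α₁ ≤ c3 / (5 * (d : ℝ) * L * B₀ * D) :=
      hs.trans ((min_le_right _ _).trans ((min_le_left _ _).trans (min_le_right _ _)))
    calc 5 * (d : ℝ) * L * B₀ * D * (α₀ + α₁) ≤ 5 * (d : ℝ) * L * B₀ * D * (c3 / (5 * (d : ℝ) * L * B₀ * D)) :=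
        mul_le_mul_of_nonneg_left h1 hK₁D.le
      _ = c3 := by field_simp
  have hs6 : D * (α₀ + α₁) ≤ 1 / 6 := by
    have h1 : α₀ + α₁ ≤ 1 / (6 * D) := hs.trans ((min_le_right _ _).trans (min_le_right _ _))
    calc D * (α₀ + α₁) ≤ D * (1 / (6 * D)) := mul_le_mul_of_nonneg_left h1 hD0.le
      _ = 1 / 6 := by field_simp
  -- the shifted pair `(α₀, α″)`
  set α'' : ℝ := 11 * (d : ℝ) ^ 2 * (α₀ + α₁) + α₁ with hα''_def
  have h11 : 0 ≤ 11 * (d : ℝ) ^ 2 * (α₀ + α₁) := by positivity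
  have h11' : 0 ≤ 11 * (d : ℝ) ^ 2 * α₁ := by positivity
  have hα'' : 0 < α'' := by rw [hα''_def]; linarith only [h11, hα₁]
  have hsum : α₀ + α'' = D * (α₀ + α₁) := by simp only [hα''_def, hD_def]; ring
  have hα₁'' : α₁ ≤ α'' := by rw [hα''_def]; linarith only [h11]
  have h165 : 11 * (d : ℝ) ^ 2 * α₀ + α₁ ≤ α'' := by rw [hα''_def]; linarith only [h11']
  -- windows at the shifted pair
  obtain ⟨-, -, -, -, w5, w6, w7, w8, w9, w10, w11, w12, -, w14, -, -, -, -⟩ :=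
    hw α₀ α'' hα₀ hα'' (hsum ▸ hsw) (5 * (d : ℝ) * L * B₀ * (α₀ + α'')) (8 * B₀' * (5 * (d : ℝ) * L * B₀) * (α₀ + α'')) rfl rfl
  obtain ⟨w19, -⟩ := hw' α₀ α'' hα₀ hα'' (hsum ▸ hsw')
  have hsmall₁ : (d : ℝ) * L * α₁ ≤ 1 / 8 := (mul_le_mul_of_nonneg_left hα₁'' (by positivity)).trans w19
  have hα2 : 2 * α₀ ≤ c2' d L := by linarith only [w6, hα₀]
  -- the data
  obtain ⟨hP1, h34, hAx⟩ := hInAAx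
  subst hP1
  -- (1.66)₀ on all bonds (Ω₀ = ℤᵈ): (1.65)
  have hpart' : ∀ x : Site d, ∃ j, j ≤ i.1.k ∧ ∃ y ∈ i.1.Λs i.1.k j, InBox (tlo L y j) (thi L y j) x := by
    intro x
    have hx : x ∈ i.1.Ω 0 := by rw [i.2]; trivial
    exact i.1.hpart x hx
  have hsm : 11 * (d : ℝ) ^ 2 * α₀ + α₁ ≤ 1 / 6 := by linarith only [h165, hα₀, hsum, hs6]
  have h66 : ∀ b ∈ {b : Site d × Fin d | SideTouches (i.1.Ω 0) b.1 b.2}, ‖((P.2.1 b.1 b.2 : 𝔸ˣ) : 𝔸) - 1‖ ≤ α'' := by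
    intro b _
    have h := norm_pert_sub_one_le_univ hd1 hL i.1.k (η := i.1.η) P.1.2 P.2.2 hα₀ w5 hα2 hα₁.le hsm
      i.1.Ω i.1.hΩ (i.1.Λs i.1.k) i.1.htower hpart' hInA h34 (hAx i.1.k le_rfl) havg b.1 b.2
    exact h.trans h165
  have h166 : (zdGF3 𝔸 L β len i.1).avgClose166 α'' P.1 P :=
    ⟨fun j hj z μ hb => (havg j hj z μ hb).trans hα₁'', h66⟩
  -- THEOREM 4 at the shifted pair
  obtain ⟨u, hR, ⟨h137'', hLan, h162⟩, huniq⟩ :=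
    H4 i.1 α₀ α'' hα₀ hα'' (hsum ▸ hs4) P.1 P hInA hReg ⟨rfl, h34, hAx⟩ h166
  -- (1.37) at the ORIGINAL α₁: the (1.42) lemma on the canonical exponent of the gauge-fixed field
  have hcs0 : 0 ≤ 5 * (d : ℝ) * L * B₀ * (α₀ + α'') := by positivity
  have hKS0 : 0 ≤ 2 * (L * (5 * (d : ℝ) * L * B₀ * (α₀ + α''))) + 8 * (8 * B₀' * (5 * (d : ℝ) * L * B₀) * (α₀ + α'')) := by
    positivity
  have hcK : 5 * (d : ℝ) * L * B₀ * (α₀ + α'') ≤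
      2 * (L * (5 * (d : ℝ) * L * B₀ * (α₀ + α''))) + 8 * (8 * B₀' * (5 * (d : ℝ) * L * B₀) * (α₀ + α'')) := by
    have h₁ : (1 : ℝ) * (5 * (d : ℝ) * L * B₀ * (α₀ + α'')) ≤ L * (5 * (d : ℝ) * L * B₀ * (α₀ + α'')) :=
      mul_le_mul_of_nonneg_right hL' hcs0
    have h₂ : 0 ≤ 8 * (8 * B₀' * (5 * (d : ℝ) * L * B₀) * (α₀ + α'')) := by positivity
    linarith only [h₁, h₂, hcs0]
  have hc16 : 16 * (5 * (d : ℝ) * L * B₀ * (α₀ + α'')) ≤ 1 := by linarith only [w7, hcK, hKS0]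
  have hu : ∀ x, u.1 x ∈ unitaryUnits 𝔸 := u.2.1
  have hW : mgauge P.1.1 u.1 (mgauge P.1.1 u.1⁻¹ P.2.1) = P.2.1 := mgauge_mgauge_inv P.1.1 P.2.1 u.1
  have hWu : ∀ x κ, mgauge P.1.1 u.1⁻¹ P.2.1 x κ ∈ unitaryUnits 𝔸 := mem_unitaryUnits_of_mgauge_eq P.1.2 P.2.2 hu hW
  have hWA : ∀ j, j ≤ i.1.k → ∀ y τ, SideTouches (i.1.Ω j) y τ →
      mgauge P.1.1 u.1⁻¹ P.2.1 y τ = cfgExp i.1.η (logCfg i.1.η (mgauge P.1.1 u.1⁻¹ P.2.1)) y τ ∧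
        ‖logCfg i.1.η (mgauge P.1.1 u.1⁻¹ P.2.1) y τ‖ ≤ (5 * (d : ℝ) * L * B₀ * (α₀ + α'')) * ((L : ℝ) ^ j * i.1.η)⁻¹ :=
    fun j hj y τ h => ⟨(h162 j hj (y, τ) h).1, (h162 j hj (y, τ) h).2.2⟩
  obtain ⟨hA'sa, hA'eq, hA'zero⟩ := mlogCfg_spec i.1.hη hL1 i.1.k P.1.1 hWu hcs0 hc16 i.1.Ω hWA
  set A' := mlogCfg i.1.k i.1.η i.1.Ω (mgauge P.1.1 u.1⁻¹ P.2.1) with hA'_def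
  have hA'bd : ∀ j, j ≤ i.1.k → ∀ y τ, SideTouches (i.1.Ω j) y τ →
      mgauge P.1.1 u.1⁻¹ P.2.1 y τ = cfgExp i.1.η A' y τ ∧
        ‖A' y τ‖ ≤ (2 * (L * (5 * (d : ℝ) * L * B₀ * (α₀ + α''))) + 8 * (8 * B₀' * (5 * (d : ℝ) * L * B₀) * (α₀ + α''))) *
          ((L : ℝ) ^ j * i.1.η)⁻¹ := by
    intro j hj y τ h
    obtain ⟨hAA, hWexp⟩ := hA'eq j hj y τ h
    refine ⟨hWexp, ?_⟩
    rw [hAA]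
    have hη0 : 0 ≤ i.1.η := i.1.hη.le
    exact ((hWA j hj y τ h).2).trans (mul_le_mul_of_nonneg_right hcK (by positivity))
  have h137 : (zdGF3 𝔸 L β len i.1).C137 α₁ P.1 ((zdGF3 𝔸 L β len i.1).act P u) :=
    B8Eq142KLevelLocal.H42_of_inAx hd2 i.1.hη hL i.1.k P.1.2 hα₀ hα₁ hKS0 w5 w6 w7 w9 w10 hsmall₁ i.1.Ω i.1.hΩ i.1.Λs i.1.Λb
      i.1.hbox i.1.hclass hInA h34 hAx havg (fun m W => IsLandau138W L m i.1.η (i.1.Ω 0) (i.1.Λs m) P.1.1 W) i.1.k i.1.hk le_rfl u.1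
      (mgauge P.1.1 u.1⁻¹ P.2.1) A' hu hW hR hLan hA'sa hA'bd hA'zero
  -- PROPOSITION 3 at (α₀, α″, α₂ := c⋆″) for the gauge-fixed field
  have hSD : α₀ + α₁ ≤ D * (α₀ + α₁) := le_mul_of_one_le_left hS0.le hD1
  have hα₀3 : α₀ ≤ c3 := by linarith only [hα₁, hSD, hs3]
  have hα''3 : α'' ≤ c3 := by linarith only [hα₀, hsum, hs3]
  have hcs3 : 5 * (d : ℝ) * L * B₀ * (α₀ + α'') ≤ c3 := by
    rw [hsum, ← mul_assoc]; exact hs3'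
  have hcspos : 0 < 5 * (d : ℝ) * L * B₀ * (α₀ + α'') := by positivity
  have h61 : 2 * (5 * (d : ℝ) * L * B₀ * (α₀ + α'')) ^ 2 + 20 * d * α₀ * (5 * (d : ℝ) * L * B₀ * (α₀ + α'')) +
      2 * (2097152 * ((d : ℝ) + 1) ^ 2) * (5 * (d : ℝ) * L * B₀ * (α₀ + α'')) ^ 2 ≤ α₀ + α'' := by
    set c := 5 * (d : ℝ) * L * B₀ * (α₀ + α'') with hc
    set K := 2 * (L * c) + 8 * (8 * B₀' * (5 * (d : ℝ) * L * B₀) * (α₀ + α'')) with hK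
    have hcKle : c ≤ K := hcK
    have hc0 : 0 ≤ c := hcs0
    have hC : (2 : ℝ) * (16 * (131072 * ((d : ℝ) + 1) ^ 2)) = 2 * (2097152 * ((d : ℝ) + 1) ^ 2) := by ring
    rw [← hC]
    have hmono : 2 * c ^ 2 + 20 * d * α₀ * c + 2 * (16 * (131072 * ((d : ℝ) + 1) ^ 2)) * c ^ 2 ≤
        2 * K ^ 2 + 20 * d * α₀ * K + 2 * (16 * (131072 * ((d : ℝ) + 1) ^ 2)) * K ^ 2 := by
      have h1 : c ^ 2 ≤ K ^ 2 := pow_le_pow_left₀ hc0 hcKle 2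
      have h2 : 0 ≤ 20 * (d : ℝ) * α₀ := by positivity
      have h3 : 0 ≤ 2 * (16 * (131072 * ((d : ℝ) + 1) ^ 2)) := by positivity
      have h4 := mul_le_mul_of_nonneg_left hcKle h2
      have h5 := mul_le_mul_of_nonneg_left h1 h3
      linarith only [h1, h4, h5]
    exact hmono.trans w14
  have hPair : (zdGF3 𝔸 L β len i.1).InAPair α₀ P.1 ((zdGF3 𝔸 L β len i.1).act P u) := by
    show InAk L i.1.k i.1.η α₀ i.1.Ω (mulCfg (mgauge P.1.1 u.1⁻¹ P.2.1) P.1.1)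
    have hui : ∀ x, u.1⁻¹ x ∈ U1 𝔸 := fun x => unitaryUnits_le_U1 ((unitaryUnits 𝔸).inv_mem (hu x))
    rw [mulCfg_eq_gaugeAct_of_mgauge_eq hW]
    exact (B8Ineq132.inAk_gaugeAct_iff L i.1.k i.1.η α₀ i.1.Ω hui _).2 h34
  have h162' : (zdGF3 𝔸 L β len i.1).C162 1 (5 * (d : ℝ) * L * B₀ * (α₀ + α'')) P.1 ((zdGF3 𝔸 L β len i.1).act P u) := by
    intro j hj b hb
    obtain ⟨h1, h2, h3⟩ := h162 j hj b hb
    exact ⟨h1, h2, by rw [one_mul]; exact h3⟩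
  obtain ⟨h136, h139⟩ := H3 i.1 α₀ α'' (5 * (d : ℝ) * L * B₀ * (α₀ + α'')) hα₀ hα₀3 hα'' hα''3 hcspos hcs3 h61 P.1
    ((zdGF3 𝔸 L β len i.1).act P u) hInA hReg hPair h162' hLan h137''
  -- constants: `5dLB₀(α₀ + α″) = B₁(α₀ + α₁)`, `5dL·B₀β·(α₀ + α″) = B₂(α₀ + α₁)`
  have e1 : 5 * (d : ℝ) * (L : ℝ) * inp.B₀ * (α₀ + α'') = B₁ * (α₀ + α₁) := by
    show 5 * (d : ℝ) * (L : ℝ) * B₀ * (α₀ + α'') = B₁ * (α₀ + α₁)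
    rw [hsum, hB₁_def]; ring
  have e2 : 5 * (d : ℝ) * (L : ℝ) * B₀β * (α₀ + α'') = B₂ * (α₀ + α₁) := by rw [hsum, hB₂_def]; ring
  obtain ⟨h136a, h136g, h136h⟩ := h136
  obtain ⟨h139j, h139l⟩ := h139
  refine ⟨u, hR, ⟨⟨fun j hj b hb => ?_, by rw [← e1]; exact h136g, by rw [← e2]; exact h136h⟩, h137, hLan,
    ⟨by rw [← e1]; exact h139j, by rw [← e1]; exact h139l⟩⟩, ?_⟩
  · obtain ⟨h1, h2, h3⟩ := h136a j hj b hb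
    exact ⟨h1, h2, by rw [← e1]; exact h3⟩
  -- uniqueness: Theorem 4's, since (1.36) at `B₁(α₀ + α₁) = B₁′(α₀ + α″)` is (1.62) there and (1.37) is monotone in α₁
  · intro u' hR' h136' h137' hLan' _
    refine huniq u' hR' ?_ hLan' ?_
    · intro j hj c hc
      have hmono : 2 * (d : ℝ) * L * α₁ ≤ 2 * d * L * α'' := mul_le_mul_of_nonneg_left hα₁'' (by positivity)
      exact (h137' j hj c hc).trans_le hmono
    · intro j hj b hb
      obtain ⟨h1, h2, h3⟩ := h136'.1 j hj b hb
      refine ⟨h1, h2, ?_⟩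
      have e1' : B₁ * (α₀ + α₁) = 5 * (d : ℝ) * L * B₀ * (α₀ + α'') := by rw [hsum, hB₁_def]; ring
      rw [← e1']
      exact h3

end Thm2

/-! ## §2 Theorem 2 as printed ((1.35) on the layers) from `B8.Thm2Printed` as a hypothesis -/

section Thm2AsPrinted

variable {𝔸 : Type} [CStarAlgebra 𝔸] [Nontrivial 𝔸]

/-- **THEOREM 2 AS PRINTED — (1.35) ON THE LAYERS — FROM THE (1.66)₁-TYPED THEOREM 2 AS A HYPOTHESIS** — the assembly of
`B8LeafModelZd3Thm2Of135.thm2_of135_zd3_univ` (chair R453 (C): (1.65) via `B8LeafModelZd3Ineq165.avgClose_zdGF3_of135` under the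
index law №11 `h16`, then the (1.66)₁-typed instance at `(α₀, α₁″ = 11d²α₀ + α₁)`, then (1.37) at print's `α₁` by the (1.42) lemma in
touching form) with `B8.Thm2Printed` on the `Ω₀ = ℤᵈ` sub-family entered AS A HYPOTHESIS `H2` (any provider chain feeds it by name).
[cite: Balaban1985RegularSpaces, Thm 2 p.83, (1.33)–(1.37) p.82, (1.65)–(1.66) p.87, (1.42) p.83, (1.6) p.77] -/
theorem thm2_of135_zd3_univ_of_thm2 (hd2 : 2 ≤ d) {L : ℕ} (hL : 2 ≤ L) {β : ℝ} {len : Site d → ℝ}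
    (H2 : B8.Thm2Printed (fun i : {i : ZdIdx d L // i.Ω 0 = Set.univ} => (zdGF3 𝔸 L β len i.1).toGFData)) :
    ∃ B₁ B₂ c₁ : ℝ, 0 < B₁ ∧ 0 < B₂ ∧ 0 < c₁ ∧
      ∀ i : {i : ZdIdx d L // i.Ω 0 = Set.univ},
        (∀ ℓ, ℓ ≤ i.1.k → ∀ w : Site d, (∀ x, InBox (tlo L w ℓ) (thi L w ℓ) x → x ∈ i.1.Ω ℓ) →
          ∃ j, ℓ ≤ j ∧ j ≤ i.1.k ∧ ∃ y ∈ i.1.Λs i.1.k j, Under L (j - ℓ) y w) →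
        ∀ α₀ α₁ : ℝ, 0 < α₀ → 0 < α₁ → α₀ + α₁ ≤ c₁ →
          ∀ (U₀ : (zdGF3 𝔸 L β len i.1).Cfg) (P : (zdGF3 𝔸 L β len i.1).Pert),
            (zdGF3 𝔸 L β len i.1).InA α₀ U₀ → (zdGF3 𝔸 L β len i.1).Reg335 α₀ U₀ → (zdGF3 𝔸 L β len i.1).InAAx α₀ U₀ P →
            (∀ j, j ≤ i.1.k → ∀ (z : Site d) (μ : Fin d), BondTouches (i.1.Λs i.1.k j) z μ →
              (∀ x, InBox (loK L j z) (bondHiK L j z μ) x → x ∈ i.1.Ω j) →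
              ‖(avgIter L (mulCfg P.2.1 U₀.1) j z μ : 𝔸) - (avgIter L U₀.1 j z μ : 𝔸)‖ ≤ α₁) →
            ∃ u : (zdGF3 𝔸 L β len i.1).GT, (zdGF3 𝔸 L β len i.1).Restricted U₀ u ∧
              ((zdGF3 𝔸 L β len i.1).C136 B₁ B₂ (α₀ + (11 * (d : ℝ) ^ 2 * α₀ + α₁)) U₀ ((zdGF3 𝔸 L β len i.1).act P u) ∧
                (zdGF3 𝔸 L β len i.1).C137 α₁ U₀ ((zdGF3 𝔸 L β len i.1).act P u) ∧
                (zdGF3 𝔸 L β len i.1).Landau U₀ ((zdGF3 𝔸 L β len i.1).act P u) ∧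
                (zdGF3 𝔸 L β len i.1).C139 B₁ (α₀ + (11 * (d : ℝ) ^ 2 * α₀ + α₁)) U₀ ((zdGF3 𝔸 L β len i.1).act P u)) ∧
              ∀ u' : (zdGF3 𝔸 L β len i.1).GT, (zdGF3 𝔸 L β len i.1).Restricted U₀ u' →
                (zdGF3 𝔸 L β len i.1).C136 B₁ B₂ (α₀ + (11 * (d : ℝ) ^ 2 * α₀ + α₁)) U₀ ((zdGF3 𝔸 L β len i.1).act P u') →
                (zdGF3 𝔸 L β len i.1).C137 α₁ U₀ ((zdGF3 𝔸 L β len i.1).act P u') →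
                (zdGF3 𝔸 L β len i.1).Landau U₀ ((zdGF3 𝔸 L β len i.1).act P u') →
                (zdGF3 𝔸 L β len i.1).C139 B₁ (α₀ + (11 * (d : ℝ) ^ 2 * α₀ + α₁)) U₀ ((zdGF3 𝔸 L β len i.1).act P u') →
                  u' = u := by
  have hL1 : 1 ≤ L := le_trans (by norm_num) hL
  have hd1 : 1 ≤ d := le_trans (by norm_num) hd2
  have hd' : (1 : ℝ) ≤ d := by exact_mod_cast hd1
  have hL' : (1 : ℝ) ≤ L := by exact_mod_cast hL1
  -- the (1.66)₁-typed instance (t2 of record at the pin) and Prop. 3's window threshold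
  obtain ⟨B₁, B₂, c₁, hB₁, hB₂, hc₁, H⟩ := H2
  obtain ⟨cN, hcN, hwin⟩ := prop3_windows hd2 hL (B₀ := 0) le_rfl
  -- constants and the threshold
  set D : ℝ := 1 + 11 * (d : ℝ) ^ 2 with hD_def
  have hD1 : 1 ≤ D := le_add_of_nonneg_right (by positivity)
  have hD0 : 0 < D := lt_of_lt_of_le one_pos hD1
  have hB₁D : 0 < B₁ * D := mul_pos hB₁ hD0
  set cT : ℝ := min (min (c₁ / D) cN) (min (min (1 / (6 * D)) (cN / (B₁ * D))) (min (1 / (16 * (B₁ * D))) (1 / (8 * (d : ℝ) * L))))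
    with hcT_def
  have hcT : 0 < cT :=
    lt_min (lt_min (div_pos hc₁ hD0) hcN) (lt_min (lt_min (by positivity) (div_pos hcN hB₁D)) (lt_min (by positivity) (by positivity)))
  refine ⟨B₁, B₂, cT, hB₁, hB₂, hcT, ?_⟩
  intro i h16 α₀ α₁ hα₀ hα₁ hs U₀ P hInA hReg hInAAx h35
  have hS0 : 0 < α₀ + α₁ := add_pos hα₀ hα₁
  -- unpack the threshold
  have hsc₁ : α₀ + α₁ ≤ c₁ / D := hs.trans ((min_le_left _ _).trans (min_le_left _ _))
  have hsN : α₀ + α₁ ≤ cN := hs.trans ((min_le_left _ _).trans (min_le_right _ _))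
  have hs6 : α₀ + α₁ ≤ 1 / (6 * D) := hs.trans ((min_le_right _ _).trans ((min_le_left _ _).trans (min_le_left _ _)))
  have hsNB : α₀ + α₁ ≤ cN / (B₁ * D) := hs.trans ((min_le_right _ _).trans ((min_le_left _ _).trans (min_le_right _ _)))
  have hs16 : α₀ + α₁ ≤ 1 / (16 * (B₁ * D)) := hs.trans ((min_le_right _ _).trans ((min_le_right _ _).trans (min_le_left _ _)))
  have hs8 : α₀ + α₁ ≤ 1 / (8 * (d : ℝ) * L) := hs.trans ((min_le_right _ _).trans ((min_le_right _ _).trans (min_le_right _ _)))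
  -- the shifted closeness constant `α₁″ = 11d²α₀ + α₁`
  set α₁'' : ℝ := 11 * (d : ℝ) ^ 2 * α₀ + α₁ with hα₁''_def
  have h11 : 0 ≤ 11 * (d : ℝ) ^ 2 * α₀ := by positivity
  have hα₁'' : 0 < α₁'' := by rw [hα₁''_def]; linarith only [h11, hα₁]
  have hα₁le : α₁ ≤ α₁'' := by rw [hα₁''_def]; linarith only [h11]
  have hsum : α₀ + α₁'' ≤ D * (α₀ + α₁) := by
    have e : D * (α₀ + α₁) = α₀ + α₁'' + 11 * (d : ℝ) ^ 2 * α₁ := by rw [hD_def, hα₁''_def]; ring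
    rw [e]; linarith only [show (0 : ℝ) ≤ 11 * (d : ℝ) ^ 2 * α₁ by positivity]
  have hsumc : α₀ + α₁'' ≤ c₁ := by
    have h := mul_le_mul_of_nonneg_left hsc₁ hD0.le
    rw [mul_div_cancel₀ _ hD0.ne'] at h
    exact hsum.trans h
  -- the windows of (1.65) at `α₀`
  have hα₀N : α₀ ≤ cN := by linarith only [hsN, hα₁]
  obtain ⟨hα3, hα4, -, -, -, -, -, -, -⟩ := hwin α₀ α₀ hα₀ hα₀N hα₀.le hα₀N
  have hα2 : 2 * α₀ ≤ c2' d L := by linarith only [hα4, hα₀]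
  have hsm : 11 * (d : ℝ) ^ 2 * α₀ + α₁ ≤ 1 / 6 := by
    have h := mul_le_mul_of_nonneg_left hs6 hD0.le
    have e : D * (1 / (6 * D)) = 1 / 6 := by field_simp
    rw [e] at h
    have : α₁'' ≤ α₀ + α₁'' := le_add_of_nonneg_left hα₀.le
    linarith only [this, hsum, h]
  -- (1.65): the member's `avgClose` at `α₁″`
  have havg : (zdGF3 𝔸 L β len i.1).avgClose α₁'' U₀ P :=
    avgClose_zdGF3_of135 hd1 hL i.1 h16 hα₀ hα3 hα2 hα₁.le hsm U₀ P hInA hInAAx h35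
  -- the (1.66)₁-typed THEOREM 2 at `(α₀, α₁″)`
  obtain ⟨u, hR, ⟨h136, -, hLan, h139⟩, huniq⟩ := H i α₀ α₁'' hα₀ hα₁'' hsumc U₀ P hInA hReg hInAAx havg
  -- (1.37) at print's `α₁`, by the (1.42) lemma in touching form on the canonical masked logarithm of `U′^{u⁻¹}`
  obtain ⟨hP1, h34, hAx⟩ := hInAAx
  subst hP1
  have hu : ∀ x, u.1 x ∈ unitaryUnits 𝔸 := u.2.1
  have hW : mgauge P.1.1 u.1 (mgauge P.1.1 u.1⁻¹ P.2.1) = P.2.1 := mgauge_mgauge_inv P.1.1 P.2.1 u.1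
  have hWu : ∀ x κ, mgauge P.1.1 u.1⁻¹ P.2.1 x κ ∈ unitaryUnits 𝔸 := mem_unitaryUnits_of_mgauge_eq P.1.2 P.2.2 hu hW
  have hcs0 : 0 ≤ B₁ * (α₀ + α₁'') := by positivity
  have hα₂N : B₁ * (α₀ + α₁'') ≤ cN := by
    have h := mul_le_mul_of_nonneg_left hsNB hB₁D.le
    rw [mul_div_cancel₀ _ hB₁D.ne'] at h
    calc B₁ * (α₀ + α₁'') ≤ B₁ * (D * (α₀ + α₁)) := mul_le_mul_of_nonneg_left hsum hB₁.le
      _ = B₁ * D * (α₀ + α₁) := by ring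
      _ ≤ cN := h
  have hc16 : 16 * (B₁ * (α₀ + α₁'')) ≤ 1 := by
    have h := mul_le_mul_of_nonneg_left hs16 (show (0 : ℝ) ≤ 16 * (B₁ * D) by positivity)
    have e : 16 * (B₁ * D) * (1 / (16 * (B₁ * D))) = 1 := by field_simp
    rw [e] at h
    calc 16 * (B₁ * (α₀ + α₁'')) ≤ 16 * (B₁ * (D * (α₀ + α₁))) := by gcongr
      _ = 16 * (B₁ * D) * (α₀ + α₁) := by ring
      _ ≤ 1 := h
  have hWA : ∀ j, j ≤ i.1.k → ∀ y τ, SideTouches (i.1.Ω j) y τ →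
      mgauge P.1.1 u.1⁻¹ P.2.1 y τ = cfgExp i.1.η (logCfg i.1.η (mgauge P.1.1 u.1⁻¹ P.2.1)) y τ ∧
        ‖logCfg i.1.η (mgauge P.1.1 u.1⁻¹ P.2.1) y τ‖ ≤ (B₁ * (α₀ + α₁'')) * ((L : ℝ) ^ j * i.1.η)⁻¹ :=
    fun j hj y τ h => ⟨(h136.1 j hj (y, τ) h).1, (h136.1 j hj (y, τ) h).2.2⟩
  obtain ⟨hA'sa, hA'eq, -⟩ := mlogCfg_spec i.1.hη hL1 i.1.k P.1.1 hWu hcs0 hc16 i.1.Ω hWA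
  set A' := mlogCfg i.1.k i.1.η i.1.Ω (mgauge P.1.1 u.1⁻¹ P.2.1) with hA'_def
  have hA'bd : ∀ j, j ≤ i.1.k → ∀ y τ, SideTouches (i.1.Ω j) y τ →
      mgauge P.1.1 u.1⁻¹ P.2.1 y τ = cfgExp i.1.η A' y τ ∧ ‖A' y τ‖ ≤ (B₁ * (α₀ + α₁'')) * ((L : ℝ) ^ j * i.1.η)⁻¹ := by
    intro j hj y τ h
    obtain ⟨hAA, hWexp⟩ := hA'eq j hj y τ h
    exact ⟨hWexp, by rw [hAA]; exact (hWA j hj y τ h).2⟩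
  -- the windows of the (1.42) lemma at `α₂ := B₁(α₀ + α₁″)`
  obtain ⟨-, -, h16w, -, hsmallw, hc₃w, -, -, -⟩ := hwin α₀ (B₁ * (α₀ + α₁'')) hα₀ hα₀N hcs0 hα₂N
  have hsmall₁ : (d : ℝ) * L * α₁ ≤ 1 / 8 := by
    have h := mul_le_mul_of_nonneg_left hs8 (show (0 : ℝ) ≤ (d : ℝ) * L by positivity)
    have e : (d : ℝ) * L * (1 / (8 * (d : ℝ) * L)) = 1 / 8 := by field_simp
    rw [e] at h
    have : (d : ℝ) * L * α₁ ≤ (d : ℝ) * L * (α₀ + α₁) := mul_le_mul_of_nonneg_left (by linarith only [hα₀]) (by positivity)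
    exact this.trans h
  have h137 : (zdGF3 𝔸 L β len i.1).C137 α₁ P.1 ((zdGF3 𝔸 L β len i.1).act P u) :=
    H42_of_inAx_touching hd2 i.1.hη hL i.1.k P.1.2 hα₀ hα₁ hcs0 hα3 hα4 h16w hsmallw hc₃w hsmall₁ i.1.Ω i.1.hΩ (i.1.Λs i.1.k)
      (i.1.Λb i.1.k) (i.1.hbox i.1.k le_rfl) (i.1.hclass i.1.k le_rfl) hInA h34 (hAx i.1.k le_rfl) h35 u.1
      (mgauge P.1.1 u.1⁻¹ P.2.1) A' hu hW hR hA'sa hA'bd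
  -- conclusion; uniqueness is the instance's, (1.37) being monotone in `α₁`
  refine ⟨u, hR, ⟨h136, h137, hLan, h139⟩, ?_⟩
  intro u' hR' h136' h137' hLan' h139'
  refine huniq u' hR' h136' ?_ hLan' h139'
  intro j hj c hc
  have hmono : 2 * (d : ℝ) * L * α₁ ≤ 2 * d * L * α₁'' := mul_le_mul_of_nonneg_left hα₁le (by positivity)
  exact (h137' j hj c hc).trans_le hmono

end Thm2AsPrinted

/-! ## §3 The re-typed leaf `B8LeafRS` at the prototype from `B8.Thm4Printed` as a hypothesis -/

section Knit

variable {𝔸 : Type} [CStarAlgebra 𝔸] [Nontrivial 𝔸]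
variable {I₃ I₄ : Type} {lan : I₃ → B8.LandauData} {cub : I₄ → B8.CubeData}

/-- **THE RE-TYPED B8 LEAF AT THE PROTOTYPE FROM THEOREM 4 AS A HYPOTHESIS**: `B8LeafKnitZd3.b8LeafRS_zd3_univ` with `t4 := H4`
(`B8.Thm4Printed (5dL·inp.B₀)` on the prototype family, restricted to the `Ω₀ = ℤᵈ` sub-family), `t2 := thm2Printed_zd3_univ_of_thm4 H4 SB9`,
`p3 := prop3Printed_zd3 SB9`, `l1 := lemma1Printed_blockPairNA`, and the five remaining printed members as hypotheses.
[cite: Balaban1985RegularSpaces, Lemma 1 p.79, Thm 2 p.83, Prop. 3 p.87, Thm 4 p.88; Prop. 5 p.94, Prop. 6 p.99, Prop. 7 p.100, Thm 8 p.101 (named hypotheses)] -/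
theorem b8LeafRS_zd3_univ_of_thm4 (hd2 : 2 ≤ d) {L : ℕ} (hL : 2 ≤ L) (Lb : ℕ) (β : ℝ) (len : Site d → ℝ) (inp : B8.B9Inputs)
    {B₀β C₂ cB9 B₁ B₂ c₁ : ℝ} (hB : 2 ≤ 5 * (d : ℝ) * L * inp.B₀) (hB₀β : 0 < B₀β)
    (hC₂ : 2097152 * ((d : ℝ) + 1) ^ 2 ≤ C₂) (hcB9 : 0 < cB9)
    (H4 : B8.Thm4Printed (5 * (d : ℝ) * L * inp.B₀) (fun i : ZdIdx d L => (zdGF3 𝔸 L β len i).toGFData))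
    (SB9 : ∀ i : ZdIdx d L, SockB9P3 (𝔸 := 𝔸) L inp.B₀ B₀β cB9 β len i.η i.k i.Ω i.Λs i.Λb)
    {toAxial : ∀ i : {i : ZdIdx d L // i.Ω 0 = Set.univ}, (zdGF3 𝔸 L β len i.1).Cfg → (zdGF3 𝔸 L β len i.1).Pert →
      (zdGF3 𝔸 L β len i.1).Pert}
    (p5e : B8.Prop5Exists inp.B₀' B₁ lan) (p5u : B8.Prop5Unique lan) (p6 : B8.Prop6Printed d (L : ℝ) B₁ c₁ cub)
    (p7 : B8SectGH.Prop7PrintedR (fun i : {i : ZdIdx d L // i.Ω 0 = Set.univ} => zdGF3 𝔸 L β len i.1) toAxial)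
    (t8 : B8Thm8Surviving.Thm8SurvivingAt 1 B₁ B₂ (fun i : {i : ZdIdx d L // i.Ω 0 = Set.univ} => zdGF3 𝔸 L β len i.1)) :
    B8LeafRS d (L : ℝ) C₂ (5 * (d : ℝ) * L * inp.B₀) inp.B₀' B₁ B₂ c₁ inp B₀β (blockPairNA d Lb 𝔸)
      (fun i : {i : ZdIdx d L // i.Ω 0 = Set.univ} => zdGF3 𝔸 L β len i.1) lan cub toAxial where
  l1 := lemma1Printed_blockPairNA d Lb 𝔸
  t2 := thm2Printed_zd3_univ_of_thm4 hd2 hL inp.B₀_pos inp.B₀'_pos hB₀β hB hcB9 H4 SB9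
  p3 := prop3Printed_precomp (fun i : {i : ZdIdx d L // i.Ω 0 = Set.univ} => i.1) d (L : ℝ) C₂ inp B₀β
    (fun i : ZdIdx d L => (zdGF3 𝔸 L β len i).toGFData2) (prop3Printed_zd3 hd2 hL inp hB₀β.le hC₂ hcB9 β len SB9)
  t4 := thm4Printed_precomp (fun i : {i : ZdIdx d L // i.Ω 0 = Set.univ} => i.1) (5 * (d : ℝ) * L * inp.B₀)
    (fun i : ZdIdx d L => (zdGF3 𝔸 L β len i).toGFData) H4
  p5e := p5e
  p5u := p5u
  p6 := p6
  p7 := p7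
  t8 := t8

/-- **… b9 AS ONE ALL-LEVELS SOCKET** (the N06 supplier's output shape `SB9all : ∀ m ≤ k, SockB9P3 … m …`, by
`B8LeafSocketsB9.sockB9P3_of_allLevels`). [cite: Balaban1985RegularSpaces, Lemma 1 p.79, Thm 2 p.83, Prop. 3 p.87, Thm 4 p.88, (1.59) p.86] -/
theorem b8LeafRS_zd3_univ_of_thm4_b9all (hd2 : 2 ≤ d) {L : ℕ} (hL : 2 ≤ L) (Lb : ℕ) (β : ℝ) (len : Site d → ℝ) (inp : B8.B9Inputs)
    {B₀β C₂ cB9 B₁ B₂ c₁ : ℝ} (hB : 2 ≤ 5 * (d : ℝ) * L * inp.B₀) (hB₀β : 0 < B₀β)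
    (hC₂ : 2097152 * ((d : ℝ) + 1) ^ 2 ≤ C₂) (hcB9 : 0 < cB9)
    (H4 : B8.Thm4Printed (5 * (d : ℝ) * L * inp.B₀) (fun i : ZdIdx d L => (zdGF3 𝔸 L β len i).toGFData))
    (SB9all : ∀ i : ZdIdx d L, ∀ m, m ≤ i.k → SockB9P3 (𝔸 := 𝔸) L inp.B₀ B₀β cB9 β len i.η m i.Ω i.Λs i.Λb)
    {toAxial : ∀ i : {i : ZdIdx d L // i.Ω 0 = Set.univ}, (zdGF3 𝔸 L β len i.1).Cfg → (zdGF3 𝔸 L β len i.1).Pert →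
      (zdGF3 𝔸 L β len i.1).Pert}
    (p5e : B8.Prop5Exists inp.B₀' B₁ lan) (p5u : B8.Prop5Unique lan) (p6 : B8.Prop6Printed d (L : ℝ) B₁ c₁ cub)
    (p7 : B8SectGH.Prop7PrintedR (fun i : {i : ZdIdx d L // i.Ω 0 = Set.univ} => zdGF3 𝔸 L β len i.1) toAxial)
    (t8 : B8Thm8Surviving.Thm8SurvivingAt 1 B₁ B₂ (fun i : {i : ZdIdx d L // i.Ω 0 = Set.univ} => zdGF3 𝔸 L β len i.1)) :
    B8LeafRS d (L : ℝ) C₂ (5 * (d : ℝ) * L * inp.B₀) inp.B₀' B₁ B₂ c₁ inp B₀β (blockPairNA d Lb 𝔸)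
      (fun i : {i : ZdIdx d L // i.Ω 0 = Set.univ} => zdGF3 𝔸 L β len i.1) lan cub toAxial :=
  b8LeafRS_zd3_univ_of_thm4 hd2 hL Lb β len inp hB hB₀β hC₂ hcB9 H4 (fun i => sockB9P3_of_allLevels (SB9all i)) p5e p5u p6 p7 t8

/-- **THEOREM 2 AS PRINTED on the `Ω₀ = ℤᵈ` sub-family FROM THEOREM 4 AS A HYPOTHESIS, b9 as one all-levels socket** —
`thm2_of135_zd3_univ_of_thm2 ∘ thm2Printed_zd3_univ_of_thm4`. [cite: Balaban1985RegularSpaces, Thm 2 p.83, (1.35) p.82, Thm 4 p.88, (1.65) p.87, (1.59) p.86] -/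
theorem thm2_of135_zd3_univ_of_thm4_b9all (hd2 : 2 ≤ d) {L : ℕ} (hL : 2 ≤ L) {β : ℝ} {len : Site d → ℝ}
    {B₀ B₀' B₀β cB9 : ℝ} (hB₀ : 0 < B₀) (hB₀' : 0 < B₀') (hB₀β : 0 < B₀β) (hB : 2 ≤ 5 * (d : ℝ) * L * B₀) (hcB9 : 0 < cB9)
    (H4 : B8.Thm4Printed (5 * (d : ℝ) * L * B₀) (fun i : ZdIdx d L => (zdGF3 𝔸 L β len i).toGFData))
    (SB9all : ∀ i : ZdIdx d L, ∀ m, m ≤ i.k → SockB9P3 (𝔸 := 𝔸) L B₀ B₀β cB9 β len i.η m i.Ω i.Λs i.Λb) :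
    ∃ B₁ B₂ c₁ : ℝ, 0 < B₁ ∧ 0 < B₂ ∧ 0 < c₁ ∧
      ∀ i : {i : ZdIdx d L // i.Ω 0 = Set.univ},
        (∀ ℓ, ℓ ≤ i.1.k → ∀ w : Site d, (∀ x, InBox (tlo L w ℓ) (thi L w ℓ) x → x ∈ i.1.Ω ℓ) →
          ∃ j, ℓ ≤ j ∧ j ≤ i.1.k ∧ ∃ y ∈ i.1.Λs i.1.k j, Under L (j - ℓ) y w) →
        ∀ α₀ α₁ : ℝ, 0 < α₀ → 0 < α₁ → α₀ + α₁ ≤ c₁ →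
          ∀ (U₀ : (zdGF3 𝔸 L β len i.1).Cfg) (P : (zdGF3 𝔸 L β len i.1).Pert),
            (zdGF3 𝔸 L β len i.1).InA α₀ U₀ → (zdGF3 𝔸 L β len i.1).Reg335 α₀ U₀ → (zdGF3 𝔸 L β len i.1).InAAx α₀ U₀ P →
            (∀ j, j ≤ i.1.k → ∀ (z : Site d) (μ : Fin d), BondTouches (i.1.Λs i.1.k j) z μ →
              (∀ x, InBox (loK L j z) (bondHiK L j z μ) x → x ∈ i.1.Ω j) →
              ‖(avgIter L (mulCfg P.2.1 U₀.1) j z μ : 𝔸) - (avgIter L U₀.1 j z μ : 𝔸)‖ ≤ α₁) →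
            ∃ u : (zdGF3 𝔸 L β len i.1).GT, (zdGF3 𝔸 L β len i.1).Restricted U₀ u ∧
              ((zdGF3 𝔸 L β len i.1).C136 B₁ B₂ (α₀ + (11 * (d : ℝ) ^ 2 * α₀ + α₁)) U₀ ((zdGF3 𝔸 L β len i.1).act P u) ∧
                (zdGF3 𝔸 L β len i.1).C137 α₁ U₀ ((zdGF3 𝔸 L β len i.1).act P u) ∧
                (zdGF3 𝔸 L β len i.1).Landau U₀ ((zdGF3 𝔸 L β len i.1).act P u) ∧
                (zdGF3 𝔸 L β len i.1).C139 B₁ (α₀ + (11 * (d : ℝ) ^ 2 * α₀ + α₁)) U₀ ((zdGF3 𝔸 L β len i.1).act P u)) ∧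
              ∀ u' : (zdGF3 𝔸 L β len i.1).GT, (zdGF3 𝔸 L β len i.1).Restricted U₀ u' →
                (zdGF3 𝔸 L β len i.1).C136 B₁ B₂ (α₀ + (11 * (d : ℝ) ^ 2 * α₀ + α₁)) U₀ ((zdGF3 𝔸 L β len i.1).act P u') →
                (zdGF3 𝔸 L β len i.1).C137 α₁ U₀ ((zdGF3 𝔸 L β len i.1).act P u') →
                (zdGF3 𝔸 L β len i.1).Landau U₀ ((zdGF3 𝔸 L β len i.1).act P u') →
                (zdGF3 𝔸 L β len i.1).C139 B₁ (α₀ + (11 * (d : ℝ) ^ 2 * α₀ + α₁)) U₀ ((zdGF3 𝔸 L β len i.1).act P u') →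
                  u' = u :=
  thm2_of135_zd3_univ_of_thm2 hd2 hL
    (thm2Printed_zd3_univ_of_thm4 hd2 hL hB₀ hB₀' hB₀β hB hcB9 H4 (fun i => sockB9P3_of_allLevels (SB9all i)))

end Knit

#print axioms thm2Printed_zd3_univ_of_thm4
#print axioms thm2_of135_zd3_univ_of_thm2
#print axioms b8LeafRS_zd3_univ_of_thm4
#print axioms b8LeafRS_zd3_univ_of_thm4_b9all
#print axioms thm2_of135_zd3_univ_of_thm4_b9all

end Literature.MathematicalPhysics.QuantumFieldTheory.Balaban1983to89.B8LeafKnitZd3OfThm4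

end
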